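import Mathlib
import Literature.AlgebraicGeometry.Motives.FrobeniusMorphism

/-!
# `PAlteration.PicoverToRadicialBottom`: Frobenius powers are universally injective

Route `ResolutionOfSingularities/pAlteration`, crux `PicoverToRadicialBottom`
(stmt-ResolutionOfSingularities-0556). Helper file (`--supports`), complementing
`PAlterationAssemblyFrobenius` (integrality / finiteness of `powEndo`; not imported here): the
remaining inputs that make the power endomorphism `F = powEndo X n` (identity on points, `s ↦ sⁿ` on functions;
`Literature.AlgebraicGeometry.Motives.powEndo`) a universal homeomorphism —

* `powEndo_stalkMap_apply`, `powEndo_residueFieldMap_apply`: on stalks `F` is `t ↦ tⁿ`, on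
  residue fields `z ↦ zⁿ`;
* `powEndo_surjective`, `powEndo_injective` (identity on points);
* `charP_residueField`: `p = 0` in `Γ(X, 𝒪_X)` forces characteristic `p` on every residue field;
* `powEndo_universallyInjective`: for `n = pʳ` on a scheme of characteristic `p`, `F` is
  universally injective (injective with purely inseparable residue maps, Stacks 01S4), and the
  `absoluteFrobenius` corollaries.

These are what the Frobenius-twist pull-back `(X ×_{F, X} Z)_red → Z` of a resolution
`Z → X'' → X` needs in order to be universally injective and surjective (crux workfile
`Cruxes/PicoverToRadicialBottom/NOTES.md` §5, stub A; Kollár 1997 §6; Stacks 0CC6–0CCB).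
-/

noncomputable section

-- single-problem summit: the doubled namespace component `ResolutionOfSingularities` is forced
set_option linter.dupNamespace false

open CategoryTheory AlgebraicGeometry Opposite TopologicalSpace
open Literature.AlgebraicGeometry.Motives

namespace Summit.ResolutionOfSingularities.ResolutionOfSingularities.Theorems

universe u

section Scheme

variable (X : Scheme.{u}) (n : ℕ) (hn : n ≠ 0)
  (hadd : ∀ (U : X.Opens) (a b : Γ(X, U)), (a + b) ^ n = a ^ n + b ^ n)

/-- The power endomorphism is surjective (it is the identity on points). [folklore] -/
theorem powEndo_surjective : Surjective (powEndo X n hn hadd) :=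
  ⟨fun x => ⟨x, rfl⟩⟩

/-- The power endomorphism is injective on points (it is the identity on points). [folklore] -/
theorem powEndo_injective : Function.Injective (powEndo X n hn hadd) := fun _ _ h => h

/-- On stalks the power endomorphism is `t ↦ tⁿ`. [folklore] -/
theorem powEndo_stalkMap_apply (x : X) (t : X.presheaf.stalk x) :
    (powEndo X n hn hadd).stalkMap x t = t ^ n := by
  obtain ⟨U, hxU, s, rfl⟩ := X.presheaf.exists_germ_eq t
  have h := Scheme.Hom.germ_stalkMap_apply (powEndo X n hn hadd) U x hxU s
  rw [powEndo_app_apply] at h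
  exact h.trans (map_pow (X.presheaf.germ U x hxU).hom s n)

/-- On residue fields the power endomorphism is `z ↦ zⁿ`. [folklore] -/
theorem powEndo_residueFieldMap_apply (x : X) (z : X.residueField x) :
    (powEndo X n hn hadd).residueFieldMap x z = z ^ n := by
  obtain ⟨t, rfl⟩ := X.residue_surjective x z
  have h := Scheme.residue_residueFieldMap (powEndo X n hn hadd) x
  have h' := DFunLike.congr_fun (CommRingCat.hom_ext_iff.mp h) t
  simp only [CommRingCat.hom_comp] at h'
  have e1 : (powEndo X n hn hadd).residueFieldMap x (X.residue x t) =
      X.residue x ((powEndo X n hn hadd).stalkMap x t) := h'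
  rw [e1, powEndo_stalkMap_apply, map_pow]

end Scheme

section PrimePower

variable (X : Scheme.{u}) (p : ℕ) [hp : Fact p.Prime]

/-- If `p = 0` in `Γ(X, 𝒪_X)` then every residue field of `X` has characteristic `p`.
[folklore] -/
theorem charP_residueField (hX : (p : Γ(X, ⊤)) = 0) (x : X) : CharP (X.residueField x) p := by
  have h1 : (p : X.presheaf.stalk x) = 0 := by
    have := congrArg (X.presheaf.germ ⊤ x trivial).hom hX
    simpa using this
  have h2 : (p : X.residueField x) = 0 := by
    have := congrArg (X.residue x).hom h1
    simpa using this
  exact ringChar.of_eq (CharP.ringChar_of_prime_eq_zero hp.out h2)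

/-- **The `pʳ`-th power endomorphism (a power of the absolute Frobenius) of a scheme of
characteristic `p` is universally injective**: it is injective on points and induces the purely
inseparable maps `z ↦ z^{pʳ}` on residue fields (Stacks 01S4). [folklore] -/
theorem powEndo_universallyInjective (hX : (p : Γ(X, ⊤)) = 0) (r : ℕ) (hr : p ^ r ≠ 0)
    (hadd : ∀ (U : X.Opens) (a b : Γ(X, U)), (a + b) ^ p ^ r = a ^ p ^ r + b ^ p ^ r) :
    UniversallyInjective (powEndo X (p ^ r) hr hadd) := by
  have key := (tfae_universallyInjective (powEndo X (p ^ r) hr hadd)).out 0 2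
  rw [key]
  refine ⟨powEndo_injective X (p ^ r) hr _, fun x => ?_⟩
  · haveI := charP_residueField X p hX x
    haveI hexp : ExpChar (X.residueField x) p := ExpChar.prime hp.out
    haveI : ExpChar (X.residueField ((powEndo X (p ^ r) hr hadd) x)) p := hexp
    algebraize [((powEndo X (p ^ r) hr hadd).residueFieldMap x).hom]
    rw [RingHom.IsPurelyInseparable, isPurelyInseparable_iff_pow_mem _ p]
    intro z
    exact ⟨r, z, powEndo_residueFieldMap_apply X (p ^ r) hr _ x z⟩

/-- If `p = 0` in `Γ(X, 𝒪_X)` then `s ↦ s^{pʳ}` is additive on every ring of sections (the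
additivity witness `powEndo` consumes; cf. `add_pow_sections` in `PAlterationAssemblyFrobenius`).
[folklore] -/
theorem add_pow_prime_pow_sections (hX : (p : Γ(X, ⊤)) = 0) (r : ℕ) (U : X.Opens)
    (a b : Γ(X, U)) : (a + b) ^ p ^ r = a ^ p ^ r + b ^ p ^ r :=
  add_pow_prime_pow_of_natCast_eq_zero p (natCast_sections_eq_zero X p hX U) r a b

/-- The `pʳ`-th power endomorphism of a scheme of characteristic `p` is universally injective,
with the additivity witness `add_pow_prime_pow_sections`. [folklore] -/
theorem powEndo_universallyInjective' (hX : (p : Γ(X, ⊤)) = 0) (r : ℕ) :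
    UniversallyInjective
      (powEndo X (p ^ r) (pow_ne_zero r hp.out.ne_zero) (add_pow_prime_pow_sections X p hX r)) :=
  powEndo_universallyInjective X p hX r _ _

end PrimePower

section Absolute

variable (X : Scheme.{u}) (p : ℕ) [hp : Fact p.Prime]

/-- The absolute Frobenius is surjective. [folklore] -/
theorem absoluteFrobenius_surjective (hX : (p : Γ(X, ⊤)) = 0) :
    Surjective (absoluteFrobenius X p hX) :=
  powEndo_surjective X p _ _

/-- **The absolute Frobenius of a scheme of characteristic `p` is universally injective** (hence,
being integral and surjective, a universal homeomorphism; Stacks 0CC8). [folklore] -/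
theorem absoluteFrobenius_universallyInjective (hX : (p : Γ(X, ⊤)) = 0) :
    UniversallyInjective (absoluteFrobenius X p hX) := by
  have h := powEndo_universallyInjective X p hX 1 (by simpa using hp.out.ne_zero)
    (add_pow_prime_pow_sections X p hX 1)
  have e : absoluteFrobenius X p hX = powEndo X (p ^ 1) (by simpa using hp.out.ne_zero)
      (add_pow_prime_pow_sections X p hX 1) := by
    unfold absoluteFrobenius
    congr 1
    · simp
  rw [e]
  exact h

end Absolute

end Summit.ResolutionOfSingularities.ResolutionOfSingularities.Theorems

end
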